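import Summits.QuantumFields.YangMills.Theorems.VirialFluxGapRingZeroSet
import HarnessLib

/-!
# Comb-gauge normal form of the zero set of the twisted ring deficit
# (layer (B1b), lattice half, of the DIRECT Laplace road to ⟨stmt-QuantumFields-24204⟩ `VirialFluxGap.SharpTwistedLaplace`)

Helper module (free-hands work of width seat ym-line-sfw-p2-w2 g49, cell ym-idea-1).  ✓`ringDeficit_eq_zero_iff` says a zero of `F_z` is a
constant ring `(U, …, U; g)` with `U` flat and `g · tw_z U = U`.  Here the flat slice is put in COMB GAUGE and the seam field is solved:

★ `exists_combGauge_of_ringDeficit_eq_zero` — for `L ≥ 2`, every twist `z`, a twist-sign field `λ` (central, `λ(0) = 1`, jumping by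
`centreElem(z_k)` across the planes `x_k = 0` and `x_k = −1`), and every ring history `P` with `F_z(P) = 0`, there are a gauge transformation
`t` (the tree gauge of the slice), commuting wraps `w : Fin 3 → SU2` and a constant `c ∈ SU2` with the TWIST-EATER RELATIONS
`c w_k c⁻¹ = centreElem(z_k) · w_k`, such that EVERY slice of `P` is `t⁻¹ · combFlat w` and the seam field is `x ↦ t(x)⁻¹ (λ(x) c) t(x)`;
★ `ringDeficit_combGauge_eq_zero` — conversely every such ring history is a zero of `F_z`.

This is fcl-p3's construction (✓`exists_flat_twisted_ring_near`, crux ⟨24320⟩) run at deficit ZERO, where every estimate becomes an identity.  With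
✓`QuantitativeLaplace.twistEater_structure` (the relations in the unit quaternions) it classifies the critical set of the Laplace phase: finitely
many gauge orbits of twist-eaters.  Everything here is PROVED; no definitions, no named facts.  HONEST FRAMING: bookkeeping∕algebra; ⟨24204⟩,
⟨24319⟩ and every rung stay OPEN; the Yang–Mills mass gap (Clay) is NOT touched; no summit is proved by a line.
-/

noncomputable section

open scoped Quaternion Matrix BigOperators
open Literature.MathematicalPhysics.QuantumFieldTheory hiding SU2
open Literature.MathematicalPhysics.QuantumLattice
open Literature.MathematicalPhysics.QuantumFieldTheory.Balaban1983to89.T4WilsonGaugeFlatDirection (su2Quat_injective)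
open Summit.QuantumFields.YangMills.Theorems.FemtoTransferGap
open Summit.QuantumFields.YangMills.Theorems.FemtoTransferGap.TT
open Summit.QuantumFields.YangMills.Theorems.FemtoTransferGap.TwoLattice
open Summit.QuantumFields.YangMills.Theorems.FemtoTransferGap.TwoLattice.Flat
open Summit.QuantumFields.YangMills.Theorems.FemtoTransferGap.TwoLattice.Cov
open Summit.QuantumFields.YangMills.Theorems.ToronValleyVolume.Lojasiewicz
open Summit.QuantumFields.YangMills.Theorems.TwistEaterVolume.Quadratic

namespace Summit.QuantumFields.YangMills.Theorems.VirialFluxGap.RingDeficit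

variable {L : ℕ} [NeZero L]

/-- `fd V W ≤ 0` forces `V = W` (`‖q V − q W‖ ≤ fd V W`, `q` injective). [folklore] -/
theorem eq_of_fd_le_zero {V W : SU2} (h : fd V W ≤ 0) : V = W := by
  have h1 : ‖su2Quat V - su2Quat W‖ ≤ 0 := (norm_su2Quat_sub_le_fd V W).trans h
  have h2 : ‖su2Quat V - su2Quat W‖ = 0 := le_antisymm h1 (norm_nonneg _)
  exact su2Quat_injective (sub_eq_zero.mp (norm_eq_zero.mp h2))

/-- ★ **Comb-gauge normal form of a zero of the twisted deficit.**  See the module docstring. [cite: Luscher1983, §2] -/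
theorem exists_combGauge_of_ringDeficit_eq_zero (hL : 2 ≤ L) (z : Fin 3 → Bool)
    {lam : Site 3 L → SU2} (hlamc : ∀ x, lam x ∈ Subgroup.center SU2) (hlam0 : lam 0 = 1)
    (hlamflip : ∀ (x : Site 3 L) (k : Fin 3), (x k = 0 ∨ x k = -1) → lam (x.shift k) = lam x * centreElem (z k))
    (hlamstay : ∀ (x : Site 3 L) (k : Fin 3), x k ≠ 0 → x k ≠ -1 → lam (x.shift k) = lam x)
    (P : (Fin (2 * L - 1 + 1) → GaugeConfig 3 L SU2) × (Site 3 L → SU2)) (hP : ringDeficit L z P = 0) :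
    ∃ (t : Site 3 L → SU2) (w : Fin 3 → SU2) (c : SU2),
      (∀ i j, w i * w j = w j * w i) ∧ (∀ k, c * w k * c⁻¹ = centreElem (z k) * w k) ∧
      (∀ i, P.1 i = gaugeTransform t⁻¹ (combFlat w)) ∧ (∀ x, P.2 x = (t x)⁻¹ * (lam x * c) * t x) := by
  haveI : Fact (1 < L) := ⟨hL⟩
  obtain ⟨hall, hflat, hseamU⟩ := (ringDeficit_eq_zero_iff z P).mp hP
  set U : GaugeConfig 3 L SU2 := P.1 0 with hU
  set g : Site 3 L → SU2 := P.2 with hg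
  have hlcomm : ∀ (x : Site 3 L) (a : SU2), lam x * a = a * lam x := fun x a => centre_comm (hlamc x) a
  -- comb gauge of the slice: at zero action every estimate is an identity
  set t : Site 3 L → SU2 := treeGauge U with ht
  have hV : treeFix U = gaugeTransform t U := rfl
  set w : Fin 3 → SU2 := wrapReps U with hw
  have hsqrt : Real.sqrt (2 * wilsonAction su2Rep U) = 0 := by rw [hflat, mul_zero, Real.sqrt_zero]
  have hVw : ∀ e, treeFix U e = combFlat w e := fun e => by
    apply eq_of_fd_le_zero
    have h := fd_treeFix_combFlat_le U e
    rw [hsqrt] at h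
    simpa using h
  have hVw' : treeFix U = combFlat w := funext hVw
  have hww : ∀ i j, w i * w j = w j * w i := fun i j => by
    have h := fd_comm_wrapReps_le U i j
    rw [hsqrt, mul_zero] at h
    have h1 : w i * w j * (w i)⁻¹ * (w j)⁻¹ = 1 := eq_of_fd_le_zero h
    calc w i * w j = w i * w j * (w i)⁻¹ * (w j)⁻¹ * (w j * w i) := by group
      _ = w j * w i := by rw [h1, one_mul]
  -- the conjugated seam field `s = t g t⁻¹` eats the twist of the comb-gauge slice
  set s : Site 3 L → SU2 := fun x => t x * g x * (t x)⁻¹ with hs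
  set sl : Site 3 L → SU2 := fun x => (lam x)⁻¹ * s x with hsl
  have hsV : gaugeTransform s (twist3 z (treeFix U)) = treeFix U := by
    rw [hV, ← gaugeTransform_twist3, hs, gaugeTransform_conj_eq, hseamU]
  -- along tree edges `sl` is constant
  have hjump : ∀ e : Edge 3 L, treeEdge e = true → fd (sl (e.1.shift e.2)) (sl e.1) ≤ 0 := by
    intro e he
    obtain ⟨x, k⟩ := e
    have hxk : x k ≠ -1 := by
      rw [treeEdge_iff] at he
      rcases he with ⟨hk, h⟩ | ⟨hk, -, h⟩ | ⟨hk, -, -, h⟩ <;> simp only at hk <;> subst hk <;> exact h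
    have hVe : treeFix U (x, k) = 1 := treeFix_eq_one_of_treeEdge U he
    set ζ : SU2 := (if x k = 0 then centreElem (z k) else 1) with hζ
    have hζc : ∀ a : SU2, ζ * a = a * ζ := fun a => by
      rw [hζ]; split_ifs
      · exact centre_comm (centreElem_mem_center (z k)) a
      · rw [one_mul, mul_one]
    have htw : twist3 z (treeFix U) (x, k) = ζ := by rw [twist3_apply, hVe, mul_one]
    have e1 : gaugeTransform s (twist3 z (treeFix U)) (x, k) = s x * ζ * (s (x.shift k))⁻¹ := by
      rw [show gaugeTransform s (twist3 z (treeFix U)) (x, k) = s x * twist3 z (treeFix U) (x, k) * (s (x.shift k))⁻¹ from rfl, htw]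
    have h1 : s x * ζ * (s (x.shift k))⁻¹ = 1 := by rw [← e1, hsV, hVe]
    have hly : lam (x.shift k) = lam x * ζ := by
      by_cases h0 : x k = 0
      · rw [hlamflip x k (Or.inl h0), hζ, if_pos h0]
      · rw [hlamstay x k h0 hxk, hζ, if_neg h0, mul_one]
    -- `s (x+k) = s x ζ`, hence `sl (x+k) = sl x`
    have h2 : s (x.shift k) = s x * ζ := by
      have := congrArg (fun u => u * s (x.shift k)) h1
      simpa [mul_assoc] using this.symm
    have hlinv : ∀ a : SU2, a * (lam x)⁻¹ = (lam x)⁻¹ * a := fun a =>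
      Subgroup.mem_center_iff.mp (Subgroup.inv_mem _ (hlamc x)) a
    have h3 : sl (x.shift k) = sl x := by
      show (lam (x.shift k))⁻¹ * s (x.shift k) = (lam x)⁻¹ * s x
      rw [h2, hly, mul_inv_rev, ← hζc (s x)]
      calc ζ⁻¹ * (lam x)⁻¹ * (ζ * s x) = (lam x)⁻¹ * ζ⁻¹ * (ζ * s x) := by rw [hlinv ζ⁻¹]
        _ = (lam x)⁻¹ * (ζ⁻¹ * (ζ * s x)) := by simp only [mul_assoc]
        _ = (lam x)⁻¹ * s x := by rw [← mul_assoc ζ⁻¹, inv_mul_cancel, one_mul]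
    rw [show ((x, k) : Edge 3 L).1 = x from rfl, show ((x, k) : Edge 3 L).2 = k from rfl, h3, fd_self]
  set c : SU2 := s 0 with hc
  have hsl0 : sl 0 = c := by show (lam 0)⁻¹ * s 0 = c; rw [hlam0, inv_one, one_mul]
  have hslc : ∀ x, sl x = c := fun x => by
    have := fd_sub_base_le_of_treeEdge (le_refl (0 : ℝ)) hjump x
    rw [hsl0, mul_zero] at this
    exact eq_of_fd_le_zero this
  have hsx : ∀ x, s x = lam x * c := fun x => by
    have hx : (lam x)⁻¹ * s x = c := hslc x
    calc s x = lam x * ((lam x)⁻¹ * s x) := by rw [mul_inv_cancel_left]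
      _ = lam x * c := by rw [hx]
  -- the wrap edges give the twist-eater relations
  have hcw : ∀ k : Fin 3, c * w k * c⁻¹ = centreElem (z k) * w k := by
    intro k
    set m : Site 3 L := mk3 (if k = 0 then (-1 : ZMod L) else 0) (if k = 1 then (-1 : ZMod L) else 0) (if k = 2 then (-1 : ZMod L) else 0)
      with hm
    have hwk : w k = treeFix U (m, k) := by rw [hw, wrapReps_eq]
    have hshift : m.shift k = 0 := wrapEdge_shift k
    have hmk : m k = -1 := by rw [hm]; fin_cases k <;> simp [mk3]
    have hm0 : m k ≠ 0 := by
      rw [hmk]; intro h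
      have : ((1 : ZMod L)) = 0 := by rw [← neg_neg (1 : ZMod L), h, neg_zero]
      have hv := ZMod.val_one L
      rw [this, ZMod.val_zero] at hv
      exact zero_ne_one hv
    have hlm : lam m = centreElem (z k) := by
      have h := hlamflip m k (Or.inr hmk)
      rw [hshift, hlam0] at h
      have h2 : lam m * centreElem (z k) * centreElem (z k) = centreElem (z k) := by rw [← h, one_mul]
      rwa [mul_assoc, centreElem_mul_self, mul_one] at h2
    have htw : twist3 z (treeFix U) (m, k) = w k := by rw [twist3_apply, if_neg hm0, one_mul, hwk]
    have e1 : gaugeTransform s (twist3 z (treeFix U)) (m, k) = s m * w k * c⁻¹ := by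
      rw [show gaugeTransform s (twist3 z (treeFix U)) (m, k) = s m * twist3 z (treeFix U) (m, k) * (s (m.shift k))⁻¹ from rfl, htw,
        hshift, hc]
    have h1 : s m * w k * c⁻¹ = w k := by rw [← e1, hsV, hwk]
    rw [hsx m, hlm] at h1
    have hεc := centre_comm (centreElem_mem_center (z k))
    -- `ε c w c⁻¹ = w` ⇒ `c w c⁻¹ = ε w` (`ε² = 1`)
    calc c * w k * c⁻¹ = centreElem (z k) * (centreElem (z k) * c * w k * c⁻¹) := by
          rw [show centreElem (z k) * (centreElem (z k) * c * w k * c⁻¹) = (centreElem (z k) * centreElem (z k)) * (c * w k * c⁻¹) by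
            simp only [mul_assoc], centreElem_mul_self, one_mul]
      _ = centreElem (z k) * w k := by rw [h1]
  refine ⟨t, w, c, hww, hcw, fun i => ?_, fun x => ?_⟩
  · -- slices: `P_i = U = t⁻¹ · treeFix U = t⁻¹ · combFlat w`
    rw [hall i, ← hVw', hV]
    exact (gaugeTransform_inv_gaugeTransform t U).symm.trans (by rfl)
  · -- seam: `g x = t x⁻¹ s x t x = t x⁻¹ (λ x c) t x`
    rw [← hsx x, hs]
    simp only [mul_assoc, inv_mul_cancel_left, inv_mul_cancel, mul_one]

/-- ★ Conversely, every comb-gauge twist-eater ring is a zero of the twisted deficit. [cite: Luscher1983, §2] -/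
theorem ringDeficit_combGauge_eq_zero (hL : 2 ≤ L) (z : Fin 3 → Bool)
    {lam : Site 3 L → SU2} (hlamc : ∀ x, lam x ∈ Subgroup.center SU2)
    (hlamflip : ∀ (x : Site 3 L) (k : Fin 3), (x k = 0 ∨ x k = -1) → lam (x.shift k) = lam x * centreElem (z k))
    (hlamstay : ∀ (x : Site 3 L) (k : Fin 3), x k ≠ 0 → x k ≠ -1 → lam (x.shift k) = lam x)
    (t : Site 3 L → SU2) {w : Fin 3 → SU2} {c : SU2}
    (hww : ∀ i j, w i * w j = w j * w i) (hcw : ∀ k, c * w k * c⁻¹ = centreElem (z k) * w k) :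
    ringDeficit L z ((fun _ => gaugeTransform t⁻¹ (combFlat w)), fun x => (t x)⁻¹ * (lam x * c) * t x) = 0 := by
  haveI : Fact (1 < L) := ⟨hL⟩
  have hlcomm : ∀ (x : Site 3 L) (a : SU2), lam x * a = a * lam x := fun x a => centre_comm (hlamc x) a
  set F : GaugeConfig 3 L SU2 := combFlat w with hF
  have hSF : wilsonAction su2Rep F = 0 := wilsonAction_combFlat_eq_zero hww
  rw [ringDeficit_eq_zero_iff]
  refine ⟨fun _ => rfl, ?_, ?_⟩
  · simp only
    rw [wilsonAction_gaugeTransform, hSF]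
  · simp only
    have hkey : gaugeTransform (fun x => lam x * c) (twist3 z F) = F := by
      funext e
      obtain ⟨x, k⟩ := e
      rw [show gaugeTransform (fun x => lam x * c) (twist3 z F) (x, k) = lam x * c * twist3 z F (x, k) * (lam (x.shift k) * c)⁻¹ from rfl,
        twist3_apply, hF, combFlat_apply]
      dsimp only
      by_cases h0 : x k = 0
      · have hne : x k ≠ -1 := by
          rw [h0]; intro h
          have : ((1 : ZMod L)) = 0 := by rw [← neg_neg (1 : ZMod L), ← h, neg_zero]
          have hv := ZMod.val_one L
          rw [this, ZMod.val_zero] at hv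
          exact zero_ne_one hv
        rw [if_pos h0, if_neg hne, hlamflip x k (Or.inl h0), mul_one, mul_inv_rev, mul_inv_rev, centreElem_inv]
        have hεc := centre_comm (centreElem_mem_center (z k))
        calc lam x * c * centreElem (z k) * (c⁻¹ * (centreElem (z k) * (lam x)⁻¹))
            = lam x * (c * centreElem (z k) * c⁻¹) * (centreElem (z k) * (lam x)⁻¹) := by simp only [mul_assoc]
          _ = lam x * centreElem (z k) * (centreElem (z k) * (lam x)⁻¹) := by
              rw [← hεc c, mul_assoc (centreElem (z k)) c c⁻¹, mul_inv_cancel, mul_one]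
          _ = 1 := by rw [mul_assoc, ← mul_assoc (centreElem (z k)), centreElem_mul_self, one_mul, mul_inv_cancel]
      · by_cases h1 : x k = -1
        · rw [if_neg h0, if_pos h1, one_mul, hlamflip x k (Or.inr h1), mul_inv_rev, mul_inv_rev, centreElem_inv]
          have hεc := centre_comm (centreElem_mem_center (z k))
          calc lam x * c * w k * (c⁻¹ * (centreElem (z k) * (lam x)⁻¹))
              = lam x * (c * w k * c⁻¹) * centreElem (z k) * (lam x)⁻¹ := by simp only [mul_assoc]
            _ = lam x * (centreElem (z k) * w k) * centreElem (z k) * (lam x)⁻¹ := by rw [hcw]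
            _ = lam x * w k * (lam x)⁻¹ := by
                rw [hεc (w k), mul_assoc (lam x), mul_assoc (w k), centreElem_mul_self, mul_one]
            _ = w k := by rw [hlcomm x (w k), mul_inv_cancel_right]
        · rw [if_neg h0, if_neg h1, one_mul, mul_one, hlamstay x k h0 h1, mul_inv_cancel]
    rw [← gaugeTransform_twist3, gaugeTransform_gaugeTransform]
    have e1 : ((fun x => (t x)⁻¹ * (lam x * c) * t x) * t⁻¹ : Site 3 L → SU2) = t⁻¹ * fun x => lam x * c := by
      funext x; simp only [Pi.mul_apply, Pi.inv_apply, mul_inv_cancel_right]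
    rw [e1, ← gaugeTransform_gaugeTransform, hkey]

end Summit.QuantumFields.YangMills.Theorems.VirialFluxGap.RingDeficit
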